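import Literature.Topology.FourManifolds.RegularLevelCollar
import Literature.Topology.FourManifolds.GradientLikeExistence
import Literature.Topology.FourManifolds.GradientLikeCongr
import Mathlib.Geometry.Manifold.VectorBundle.ContMDiffSection
import HarnessLib

/-!
# A unit-speed field across a regular level which is gradient-like for the Morse function
# (Milnor 1965, Lemma 3.2 with the normalisation `ξ/ξ(f)` of the proof of Thm. 3.4)

Topic `Literature/Topology/FourManifolds`; infrastructure for the fact seat
`provefact-Literature.Topology.FourManifolds.exists_isBalancedGKTrisection` (Gay–Kirby 2016,
Thm. 4 via Lemma 14: the sectors are cut out of the closed `4`-manifold along the trajectories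
of a gradient-like field of the Morse function `f`, and near the level `∂X₁ = f⁻¹(3/2)` the
bi-collar coordinates of `TrisectionsBiCollar.lean` want that field to have unit speed,
`ξ(f) = 1`; this file provides one field doing both).  Everything here is **proved**; no named
facts are introduced.

Milnor, *Lectures on the h-cobordism theorem* (1965), Lemma 3.2 (PDF p. 12): *"For every Morse
function `f` on a triad `(W; V₀, V₁)` there exists a gradient-like vector field `ξ`"*; proof of
Thm. 3.4 (PDF pp. 12–13): *"Multiplying `ξ` by the smooth positive function `1/ξ(f)` we may
assume `ξ(f) = 1` identically"* — there on a triad without critical points; here the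
normalisation is performed only on a band `f⁻¹[a - δ, a + δ]` around a regular level `a` of a
Morse function on a closed manifold, keeping the field unchanged near the critical points, so
that it stays gradient-like (Def. 3.1: `ξ(f) > 0` off the critical points and Milnor's normal
form near them):

* `IsMorse.exists_levelUnitField_isGradientLike` — for a Morse function `f` on a compact
  manifold without boundary and a level `a` through no critical point there is a
  `Literature.Topology.FourManifolds.LevelUnitField n f a` (`RegularLevelCollar.lean`) whose field
  is gradient-like for `f` (`Literature.Topology.FourManifolds.IsGradientLike`).  Proof: take a
  smooth gradient-like `ζ` (the tree's `IsMorse.exists_isGradientLike`, Lemma 3.2 proved); `ζ(f)`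
  is smooth (`contMDiff_mlineDeriv_section`) and has a positive minimum `m₀` on the compact band;
  with a smooth `φ : M → [0, 1]` equal to `1` on the band and to `0` on `{ζ(f) ≤ 2m₀/3}` (a
  closed neighbourhood of the critical set; Mathlib's `exists_contMDiffMap_zero_one_of_isClosed`)
  put `ρ = φ/ζ(f) + (1 - φ)` — smooth and positive, `= 1/ζ(f)` on the band, `= 1` on
  `{ζ(f) < 2m₀/3}` — and `ξ = ρ ζ`: then `ξ(f) = ρ ζ(f)` is `1` on the band and positive off
  the critical set, and `ξ = ζ` near the critical points (`IsGradientLike.of_locallyEq`).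

## References

* J. Milnor, *Lectures on the h-cobordism theorem*, Princeton (1965), Def. 3.1, Lemma 3.2,
  proof of Thm. 3.4 (PDF pp. 11–13 of the held copy). [MilnorHCobordism1965]
-/

open scoped Manifold ContDiff Topology
open Set Function

noncomputable section

universe u

namespace Literature.Topology.FourManifolds

variable {n : ℕ} {M : Type u} [TopologicalSpace M] [T2Space M]
  [CompactSpace M] [ChartedSpace (EuclideanSpace ℝ (Fin (n + 1))) M] [IsManifold (𝓡 (n + 1)) ∞ M]

omit [T2Space M] [CompactSpace M] [IsManifold (𝓡 (n + 1)) ∞ M] in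
/-- At a critical point `ξ(f) = 0` for every vector `ξ`. [cite: MilnorHCobordism1965, Def. 3.1] -/
theorem mlineDeriv_eq_zero_of_isMCriticalPt {f : M → ℝ} {p : M} (hp : IsMCriticalPt (𝓡 (n + 1)) f p)
    (v : TangentSpace (𝓡 (n + 1)) p) : mlineDeriv (𝓡 (n + 1)) f p v = 0 := by
  rw [mlineDeriv_def]
  have h : mfderiv (𝓡 (n + 1)) 𝓘(ℝ, ℝ) f p = 0 := hp
  rw [h]; rfl

/-- **A unit-speed field across a regular level which is gradient-like for the Morse function**
(Milnor 1965, Lemma 3.2 and the normalisation of the proof of Thm. 3.4, performed on a band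
around the level only). [cite: MilnorHCobordism1965, Lemma 3.2 and proof of Thm. 3.4] -/
theorem IsMorse.exists_levelUnitField_isGradientLike {f : M → ℝ} (hf : IsMorse (𝓡 (n + 1)) f) {a : ℝ}
    (ha : IsRegularLevel (𝓡 (n + 1)) f a) :
    ∃ U : LevelUnitField n f a, IsGradientLike (𝓡 (n + 1)) f U.ξ := by
  have hfs : ContMDiff (𝓡 (n + 1)) 𝓘(ℝ, ℝ) ∞ f := hf.1
  -- a smooth gradient-like field `ζ`
  obtain ⟨ζ, hζ⟩ := hf.exists_isGradientLike (fun p _ => BoundarylessManifold.isInteriorPoint)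
  have hζs : ContMDiff (𝓡 (n + 1)) (𝓡 (n + 1)).tangent ∞
      fun x => (⟨x, ζ x⟩ : TangentBundle (𝓡 (n + 1)) M) := ζ.contMDiff
  -- a band around the level without critical points
  have hreg0 : ∀ x, f x ∈ Icc a a → mfderiv (𝓡 (n + 1)) 𝓘(ℝ, ℝ) f x ≠ 0 := fun x hx =>
    ha.not_isMCriticalPt (le_antisymm hx.2 hx.1)
  obtain ⟨δ, hδ, hreg⟩ := exists_pos_forall_mem_Icc_mfderiv_ne_zero hfs hreg0
  set Bd : Set M := f ⁻¹' Icc (a - δ) (a + δ) with hBd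
  have hBdc : IsClosed Bd := isClosed_Icc.preimage hfs.continuous
  have hBdK : IsCompact Bd := hBdc.isCompact
  -- `ζ(f)` is smooth and positive on the band
  set ζf : M → ℝ := fun x => mlineDeriv (𝓡 (n + 1)) f x (ζ x) with hζf
  have hζfs : ContMDiff (𝓡 (n + 1)) 𝓘(ℝ, ℝ) ∞ ζf := contMDiff_mlineDeriv_section hfs hζs
  have hζfc : Continuous ζf := hζfs.continuous
  have hζfpos : ∀ x ∈ Bd, 0 < ζf x := fun x hx => hζ.mlineDeriv_pos x (hreg x hx)
  -- a positive lower bound `m₀` of `ζ(f)` on the band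
  obtain ⟨m₀, hm₀, hm₀le⟩ : ∃ m₀ : ℝ, 0 < m₀ ∧ ∀ x ∈ Bd, m₀ ≤ ζf x := by
    by_cases hne : Bd.Nonempty
    · obtain ⟨x₀, hx₀, hmin⟩ := hBdK.exists_isMinOn hne hζfc.continuousOn
      exact ⟨ζf x₀, hζfpos x₀ hx₀, fun x hx => hmin hx⟩
    · exact ⟨1, one_pos, fun x hx => (hne ⟨x, hx⟩).elim⟩
  -- a smooth cut-off `φ`: `1` on the band, `0` on `{ζ(f) ≤ 2 m₀ / 3}`
  set mlo : ℝ := m₀ / 3 with hmlo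
  set mhi : ℝ := 2 * m₀ / 3 with hmhi
  have hmlo0 : 0 < mlo := by rw [hmlo]; linarith
  have hlt : mlo < mhi := by rw [hmlo, hmhi]; linarith
  have hhi : mhi < m₀ := by rw [hmhi]; linarith
  have hZc : IsClosed {x : M | ζf x ≤ mhi} := isClosed_le hζfc continuous_const
  have hdisj : Disjoint {x : M | ζf x ≤ mhi} Bd := by
    rw [disjoint_left]
    intro x hx hxB
    exact absurd ((hm₀le x hxB).trans hx) (not_le.2 hhi)
  obtain ⟨φ, hφ0, hφ1, hφ01⟩ := exists_contMDiffMap_zero_one_of_isClosed (I := 𝓡 (n + 1)) (n := ⊤) hZc hBdc hdisj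
  have hφs : ContMDiff (𝓡 (n + 1)) 𝓘(ℝ, ℝ) ∞ φ := φ.contMDiff
  -- the rescaling factor `ρ = φ / ζ(f) + (1 - φ)`
  set ρ : M → ℝ := fun x => φ x / ζf x + (1 - φ x) with hρ
  have hρ_of_lt : ∀ x, ζf x < mhi → ρ x = 1 := fun x hx => by
    have : φ x = 0 := hφ0 (le_of_lt hx)
    simp only [hρ, this, zero_div, sub_zero, zero_add]
  have hρB : ∀ x ∈ Bd, ρ x = 1 / ζf x := fun x hx => by
    have : φ x = 1 := hφ1 hx
    simp only [hρ, this, sub_self, add_zero]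
  have hρpos : ∀ x, 0 < ρ x := fun x => by
    rcases lt_or_ge (ζf x) mhi with h | h
    · rw [hρ_of_lt x h]; exact one_pos
    · have hζx : 0 < ζf x := hmlo0.trans (hlt.trans_le h)
      have h01 := hφ01 x
      show 0 < φ x / ζf x + (1 - φ x)
      rcases h01.2.lt_or_eq with hφlt | hφeq
      · have : 0 ≤ φ x / ζf x := div_nonneg h01.1 hζx.le
        linarith
      · rw [hφeq, sub_self, add_zero]; exact div_pos one_pos hζx
  have hρs : ContMDiff (𝓡 (n + 1)) 𝓘(ℝ, ℝ) ∞ ρ := by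
    intro x
    rcases lt_or_ge (ζf x) mhi with h | h
    · -- near `x`, `ρ = 1`
      have hopen : IsOpen {y : M | ζf y < mhi} := isOpen_lt hζfc continuous_const
      have hev : ρ =ᶠ[𝓝 x] fun _ => 1 := by
        filter_upwards [hopen.mem_nhds h] with y hy
        exact hρ_of_lt y hy
      exact contMDiffAt_const.congr_of_eventuallyEq hev
    · -- near `x`, `ζ(f) > mlo > 0` and the formula is smooth
      have hopen : IsOpen {y : M | mlo < ζf y} := isOpen_lt continuous_const hζfc
      have hx : x ∈ {y : M | mlo < ζf y} := hlt.trans_le h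
      have hon : ContMDiffOn (𝓡 (n + 1)) 𝓘(ℝ, ℝ) ∞ ρ {y : M | mlo < ζf y} :=
        ((hφs.contMDiffOn.div₀ hζfs.contMDiffOn fun y hy => (hmlo0.trans hy).ne')).add
          (contMDiffOn_const.sub hφs.contMDiffOn)
      exact hon.contMDiffAt (hopen.mem_nhds hx)
  -- the field `ξ = ρ ζ`
  set ξ : Π x : M, TangentSpace (𝓡 (n + 1)) x := fun x => ρ x • ζ x with hξ
  have hξs : ContMDiff (𝓡 (n + 1)) (𝓡 (n + 1)).tangent ∞
      fun x => (⟨x, ξ x⟩ : TangentBundle (𝓡 (n + 1)) M) :=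
    ContMDiff.smul_section (I := 𝓡 (n + 1)) (F := EuclideanSpace ℝ (Fin (n + 1))) (V := TangentSpace (𝓡 (n + 1))) hρs hζs
  have hξf : ∀ x, mlineDeriv (𝓡 (n + 1)) f x (ξ x) = ρ x * ζf x := fun x => mlineDeriv_smul f x (ρ x) (ζ x)
  refine ⟨⟨ξ, hξs, hfs, δ, hδ, fun x hx => ?_⟩, ?_⟩
  · rw [hξf, hρB x hx, one_div, inv_mul_cancel₀ (hζfpos x hx).ne']
  · refine hζ.of_locallyEq (fun p hp => ?_) (fun p hp => ?_)
    · rw [hξf]; exact mul_pos (hρpos p) (hζ.mlineDeriv_pos p hp)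
    · refine ⟨{y : M | ζf y < mhi}, isOpen_lt hζfc continuous_const, ?_, fun _ _ => rfl, fun q hq => ?_⟩
      · show ζf p < mhi
        rw [show ζf p = 0 from mlineDeriv_eq_zero_of_isMCriticalPt hp _]
        exact hmlo0.trans hlt
      · show ρ q • ζ q = ζ q
        rw [hρ_of_lt q hq, one_smul]

end Literature.Topology.FourManifolds

end
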